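import Summits.CriticalPhenomena.SAWScalingLimit.Theorems.SAWDefectDecoherenceBoundaryClosureRHolomorphicWeakLimits
import Summits.CriticalPhenomena.SAWScalingLimit.Theorems.SAWDefectDecoherenceBoundaryClosureRGateTraceNecessity
import Summits.CriticalPhenomena.SAWScalingLimit.Theorems.SAWDefectDecoherenceBoundaryClosureRFrameDatum
import Summits.CriticalPhenomena.SAWScalingLimit.Theorems.SAWDefectDecoherenceBoundaryClosureRLocalL1RootNecessity
import Summits.CriticalPhenomena.SAWScalingLimit.Theorems.SAWDefectDecoherenceBoundaryClosureRIdentificationOfGateTrace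
import Summits.CriticalPhenomena.SAWScalingLimit.Theorems.SAWDefectDecoherenceConjugateClassNegligibleOfCruxes
import HarnessLib

/-!
# `BoundaryClosureR` is equivalent to its two necessary inputs (crux stmt-CriticalPhenomena-14004,
# route `SAWDefectDecoherence`, line `pick-half-plane`, skeleton r15)

The crux `BoundaryClosureR := DefectDecoherence → MassRatio → HexObservableLimitR` (the boundary
Riemann–Hilbert half of Duminil-Copin–Smirnov's Conjecture 2 over the repaired, doubly pinned target,
given the route's two exponent cruxes) is EQUIVALENT to the conditional conjunction of two statements
about the critical hexagonal SAW parafermionic observable at the target's own root, each of which is a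
CONSEQUENCE of the target:

* the **local `L¹` law at the root** — on compacts of the carrier the `b`-normalised observable has
  eventually bounded `L¹` mass (necessary by Banach–Steinhaus, `LocalL1.localL1Root_of_target` p122434
  with the conformal datum of `Identification.frameDatum_exists` p122275);
* the **gate trace of holomorphic weak limits** — one universal `c ≠ 0` such that every function
  holomorphic on the carrier that is a subsequential weak limit of the normalised bulk functionals
  satisfies `g · exp(−(5/8)(L − L_b)) → c` at every point of the flat gate (necessary by uniqueness of
  weak limits, `Identification.gateTraceH_of_target` p121923).

Sufficiency (`target_of_inputs`): the exponent cruxes give `ConjugateClassNegligible`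
(`conjugateClassNegligible_of_exponent_cruxes`); with the `L¹` law the landed `L¹` engine
(`LocalL1.holWeakLimits_of_localL1` p121571: weak-* limits, weak `∂̄`-closure, Weyl on balls, patching)
yields holomorphic weak limits along subsequences of every mesh sequence; the gate trace identifies them
(`Identification.identification_of_gateTrace_core` p94078: Schwarz reflection + identity theorem); the
subsequence principle on the countably generated filter `𝓝[>] 0` concludes.  Hence
`target_iff_inputs : DefectDecoherence → MassRatio → (HexObservableLimitR ↔ L¹-law ∧ gate-trace)` and
`boundaryClosureR_iff_inputs : BoundaryClosureR ↔ (DefectDecoherence → MassRatio → L¹-law ∧ gate-trace)`.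
All statements are written with the skeleton's line-local bundles (`AdmissibleFamily`, `PinnedFlatRoot`
at `D.pt 0`, `IsWeakLimit`, `IsTest`) UNFOLDED verbatim.  No new definitions.
-/

noncomputable section

open scoped BigOperators Topology
open Filter Set MeasureTheory
open Literature.Probability.LatticeModels Literature.Probability.RandomPlanarGeometry
open Literature.Probability.RandomPlanarGeometry.SAW
open Summit.CriticalPhenomena.SAWScalingLimit.Theses.SAWDefectDecoherence

namespace Summit.CriticalPhenomena.SAWScalingLimit.Theorems.PickHalfPlane.Equivalence

/-- **Sufficiency of the two inputs** (r15 composition): the exponent cruxes, the local `L¹` law at the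
root and the gate trace of holomorphic weak limits give the target `HexObservableLimitR`
(`conjugateClassNegligible_of_exponent_cruxes` + `holWeakLimits_of_localL1` +
`identification_of_gateTrace_core` + the subsequence principle). -/
theorem target_of_inputs (hDD : DefectDecoherence) (hMR : MassRatio)
    (h1 : (∀ (D : DobrushinDomain) (ρ : ℝ) (Λ : ℝ → Finset HexVertex) (m : ℝ → ℤ) (b : ℝ → Sym2 HexVertex),
      (0 < ρ ∧
        D.carrier ∩ Metric.ball (D.pt 1) ρ = {z : ℂ | (D.pt 1).im < z.im} ∩ Metric.ball (D.pt 1) ρ ∧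
        (∀ᶠ δ : ℝ in 𝓝[>] 0, hexDomainSimplyConnected (Λ δ) ∧ b δ ∈ hexDomainBoundary (Λ δ) ∧
            (hexGraph.induce ((Λ δ : Finset HexVertex) : Set HexVertex)).Preconnected ∧
            (∀ v ∈ Λ δ, (δ : ℂ) * hexCenter v ∈ D.carrier) ∧
            (∀ v : HexVertex, (δ : ℂ) * hexCenter v ∈ Metric.ball (D.pt 1) ρ →
              (v ∈ Λ δ ↔ m δ ≤ v.1 1))) ∧
        (∀ K : Set ℂ, IsCompact K → K ⊆ D.carrier →
            ∀ᶠ δ : ℝ in 𝓝[>] 0, ∀ v : HexVertex, (δ : ℂ) * hexCenter v ∈ K → v ∈ Λ δ) ∧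
        Tendsto (fun δ : ℝ => (δ : ℂ) * hexMidpoint (b δ)) (𝓝[>] 0) (𝓝 (D.pt 1))) →
    ∀ (a : ℝ → Sym2 HexVertex) (r₀ : ℝ) (m₀ : ℝ → ℤ),
      (0 < r₀ ∧
        D.carrier ∩ Metric.ball (D.pt 0) r₀ = {z : ℂ | (D.pt 0).im < z.im} ∩ Metric.ball (D.pt 0) r₀ ∧
        (∀ᶠ δ : ℝ in 𝓝[>] 0, a δ ∈ hexDomainBoundary (Λ δ) ∧
            Nonempty (HexMidEdgeSAW (Λ δ) (a δ) (b δ)) ∧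
            (∀ v : HexVertex, (δ : ℂ) * hexCenter v ∈ Metric.ball (D.pt 0) r₀ →
              (v ∈ Λ δ ↔ m₀ δ ≤ v.1 1))) ∧
        Tendsto (fun δ : ℝ => (δ : ℂ) * hexMidpoint (a δ)) (𝓝[>] 0) (𝓝 (D.pt 0))) →
    ∀ K : Set ℂ, IsCompact K → K ⊆ D.carrier → ∃ C : ℝ, ∀ᶠ δ : ℝ in 𝓝[>] 0,
      δ ^ 2 * (∑ᶠ z ∈ {z : Sym2 HexVertex | z ∈ hexDomainMidEdges (Λ δ) ∧ (δ : ℂ) * hexMidpoint z ∈ K},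
          ‖hexParafermionicObservable (Λ δ) (a δ) hexCriticalFugacity (5 / 8) z‖) ≤
        C * ‖hexParafermionicObservable (Λ δ) (a δ) hexCriticalFugacity (5 / 8) (b δ)‖))
    (h2 : (∃ c : ℂ, c ≠ 0 ∧
    ∀ (D : DobrushinDomain) (ρ : ℝ) (Λ : ℝ → Finset HexVertex) (m : ℝ → ℤ) (b : ℝ → Sym2 HexVertex),
      (0 < ρ ∧
        D.carrier ∩ Metric.ball (D.pt 1) ρ = {z : ℂ | (D.pt 1).im < z.im} ∩ Metric.ball (D.pt 1) ρ ∧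
        (∀ᶠ δ : ℝ in 𝓝[>] 0, hexDomainSimplyConnected (Λ δ) ∧ b δ ∈ hexDomainBoundary (Λ δ) ∧
            (hexGraph.induce ((Λ δ : Finset HexVertex) : Set HexVertex)).Preconnected ∧
            (∀ v ∈ Λ δ, (δ : ℂ) * hexCenter v ∈ D.carrier) ∧
            (∀ v : HexVertex, (δ : ℂ) * hexCenter v ∈ Metric.ball (D.pt 1) ρ →
              (v ∈ Λ δ ↔ m δ ≤ v.1 1))) ∧
        (∀ K : Set ℂ, IsCompact K → K ⊆ D.carrier →
            ∀ᶠ δ : ℝ in 𝓝[>] 0, ∀ v : HexVertex, (δ : ℂ) * hexCenter v ∈ K → v ∈ Λ δ) ∧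
        Tendsto (fun δ : ℝ => (δ : ℂ) * hexMidpoint (b δ)) (𝓝[>] 0) (𝓝 (D.pt 1))) →
    ∀ (a : ℝ → Sym2 HexVertex) (r₀ : ℝ) (m₀ : ℝ → ℤ),
      (0 < r₀ ∧
        D.carrier ∩ Metric.ball (D.pt 0) r₀ = {z : ℂ | (D.pt 0).im < z.im} ∩ Metric.ball (D.pt 0) r₀ ∧
        (∀ᶠ δ : ℝ in 𝓝[>] 0, a δ ∈ hexDomainBoundary (Λ δ) ∧
            Nonempty (HexMidEdgeSAW (Λ δ) (a δ) (b δ)) ∧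
            (∀ v : HexVertex, (δ : ℂ) * hexCenter v ∈ Metric.ball (D.pt 0) r₀ →
              (v ∈ Λ δ ↔ m₀ δ ≤ v.1 1))) ∧
        Tendsto (fun δ : ℝ => (δ : ℂ) * hexMidpoint (a δ)) (𝓝[>] 0) (𝓝 (D.pt 0))) →
    ∀ (Φ : ConformalEquiv D.carrier UpperHalfPlane.upperHalfPlaneSet) (L : ℂ → ℂ) (Lb : ℂ),
      Tendsto (fun z => ‖Φ z‖) (𝓝[D.carrier] (D.pt 0)) atTop → Φ.HasBoundaryValue (D.pt 1) 0 →
      ContinuousOn L D.carrier → (∀ z ∈ D.carrier, Complex.exp (L z) = deriv Φ z) →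
      Tendsto L (𝓝[D.carrier] (D.pt 1)) (𝓝 Lb) →
    ∀ ns : ℕ → ℝ, Tendsto ns atTop (𝓝[>] 0) →
    ∀ g : ℂ → ℂ, DifferentiableOn ℂ g D.carrier →
      (∀ ψ : ℂ → ℂ, (Continuous ψ ∧ HasCompactSupport ψ ∧ tsupport ψ ⊆ D.carrier) →
        Tendsto (fun n => ((ns n : ℝ) : ℂ) ^ 2 * (∑ᶠ z ∈ hexDomainMidEdges (Λ (ns n)),
            ψ (((ns n : ℝ) : ℂ) * hexMidpoint z) *
              hexParafermionicObservable (Λ (ns n)) (a (ns n)) hexCriticalFugacity (5 / 8) z) /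
          hexParafermionicObservable (Λ (ns n)) (a (ns n)) hexCriticalFugacity (5 / 8) (b (ns n)))
          atTop (𝓝 (∫ z, ψ z * g z))) →
      ∀ y : ℂ, y.im = (D.pt 1).im → y ∈ Metric.ball (D.pt 1) ρ →
        Tendsto (fun z => g z * Complex.exp (-((5 / 8 : ℂ) * (L z - Lb)))) (𝓝[D.carrier] y) (𝓝 c))) :
    HexObservableLimitR := by
  obtain ⟨c, hc, hGT⟩ := h2
  refine ⟨c, hc, ?_⟩
  intro D ρ Λ m a b Φ L Lb ψ F hρ hflat hadm hexh ha hb hΦ hΦb hL hexpL hLb hψc hψK hψD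
  have hCCN : ConjugateClassNegligible :=
    Summit.CriticalPhenomena.SAWScalingLimit.Theorems.conjugateClassNegligible_of_exponent_cruxes hDD hMR
  -- repackage the hypotheses into the two bundles
  have hAF : (0 < ρ ∧
      D.carrier ∩ Metric.ball (D.pt 1) ρ = {z : ℂ | (D.pt 1).im < z.im} ∩ Metric.ball (D.pt 1) ρ ∧
      (∀ᶠ δ : ℝ in 𝓝[>] 0, hexDomainSimplyConnected (Λ δ) ∧ b δ ∈ hexDomainBoundary (Λ δ) ∧
          (hexGraph.induce ((Λ δ : Finset HexVertex) : Set HexVertex)).Preconnected ∧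
          (∀ v ∈ Λ δ, (δ : ℂ) * hexCenter v ∈ D.carrier) ∧
          (∀ v : HexVertex, (δ : ℂ) * hexCenter v ∈ Metric.ball (D.pt 1) ρ →
            (v ∈ Λ δ ↔ m 1 δ ≤ v.1 1))) ∧
      (∀ K : Set ℂ, IsCompact K → K ⊆ D.carrier →
          ∀ᶠ δ : ℝ in 𝓝[>] 0, ∀ v : HexVertex, (δ : ℂ) * hexCenter v ∈ K → v ∈ Λ δ) ∧
      Tendsto (fun δ : ℝ => (δ : ℂ) * hexMidpoint (b δ)) (𝓝[>] 0) (𝓝 (D.pt 1))) := by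
    refine ⟨hρ, hflat 1, ?_, hexh, hb⟩
    filter_upwards [hadm] with δ hδ
    exact ⟨hδ.1, hδ.2.2.1, hδ.2.2.2.2.1, hδ.2.2.2.2.2.1, hδ.2.2.2.2.2.2 1⟩
  have hPR : (0 < ρ ∧
      D.carrier ∩ Metric.ball (D.pt 0) ρ = {z : ℂ | (D.pt 0).im < z.im} ∩ Metric.ball (D.pt 0) ρ ∧
      (∀ᶠ δ : ℝ in 𝓝[>] 0, a δ ∈ hexDomainBoundary (Λ δ) ∧
          Nonempty (HexMidEdgeSAW (Λ δ) (a δ) (b δ)) ∧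
          (∀ v : HexVertex, (δ : ℂ) * hexCenter v ∈ Metric.ball (D.pt 0) ρ →
            (v ∈ Λ δ ↔ m 0 δ ≤ v.1 1))) ∧
      Tendsto (fun δ : ℝ => (δ : ℂ) * hexMidpoint (a δ)) (𝓝[>] 0) (𝓝 (D.pt 0))) := by
    refine ⟨hρ, hflat 0, ?_, ha⟩
    filter_upwards [hadm] with δ hδ
    exact ⟨hδ.2.1, hδ.2.2.2.1, hδ.2.2.2.2.2.2 0⟩
  -- the subsequence principle on the countably generated filter `𝓝[>] 0`
  refine Filter.tendsto_of_subseq_tendsto fun ns hns => ?_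
  obtain ⟨ms, hms, g, hg, hw⟩ :=
    Summit.CriticalPhenomena.SAWScalingLimit.Theorems.PickHalfPlane.LocalL1.holWeakLimits_of_localL1 hCCN
      D ρ Λ (m 1) b hAF a ρ (m 0) hPR (h1 D ρ Λ (m 1) b hAF a ρ (m 0) hPR) ns hns
  have hns' : Tendsto (ns ∘ ms) atTop (𝓝[>] 0) := hns.comp hms.tendsto_atTop
  have hid : ∀ z ∈ D.carrier, g z = c * Complex.exp ((5 / 8 : ℂ) * (L z - Lb)) :=
    Summit.CriticalPhenomena.SAWScalingLimit.Theorems.PickHalfPlane.Identification.identification_of_gateTrace_core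
      D ρ Φ L Lb c g hρ (hflat 1) hL hexpL hg
      (hGT D ρ Λ (m 1) b hAF a ρ (m 0) hPR Φ L Lb hΦ hΦb hL hexpL hLb (ns ∘ ms) hns' g hg hw)
  -- the limit density is `c · exp((5/8)(L - Lb))` on the domain and `ψ` vanishes off the domain
  have hint : ∫ z, ψ z * g z = c * ∫ z, ψ z * Complex.exp ((5 / 8 : ℂ) * (L z - Lb)) := by
    rw [← integral_const_mul]
    refine integral_congr_ae (Filter.Eventually.of_forall fun z => ?_)
    by_cases hz : z ∈ D.carrier
    · simp only [hid z hz]; ring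
    · have hψz : ψ z = 0 := image_eq_zero_of_notMem_tsupport fun h => hz (hψD h)
      simp only [hψz, zero_mul, mul_zero]
  have key := hw ψ ⟨hψc, hψK, hψD⟩
  rw [hint] at key
  exact ⟨ms, key⟩

/-- **Necessity of the two inputs**: the target implies the local `L¹` law at the root (Banach–Steinhaus,
`localL1Root_of_target` with the datum of `frameDatum_exists`) and the gate trace of holomorphic weak
limits (`gateTraceH_of_target`). -/
theorem inputs_of_target (hX : HexObservableLimitR) :
    (∀ (D : DobrushinDomain) (ρ : ℝ) (Λ : ℝ → Finset HexVertex) (m : ℝ → ℤ) (b : ℝ → Sym2 HexVertex),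
      (0 < ρ ∧
        D.carrier ∩ Metric.ball (D.pt 1) ρ = {z : ℂ | (D.pt 1).im < z.im} ∩ Metric.ball (D.pt 1) ρ ∧
        (∀ᶠ δ : ℝ in 𝓝[>] 0, hexDomainSimplyConnected (Λ δ) ∧ b δ ∈ hexDomainBoundary (Λ δ) ∧
            (hexGraph.induce ((Λ δ : Finset HexVertex) : Set HexVertex)).Preconnected ∧
            (∀ v ∈ Λ δ, (δ : ℂ) * hexCenter v ∈ D.carrier) ∧
            (∀ v : HexVertex, (δ : ℂ) * hexCenter v ∈ Metric.ball (D.pt 1) ρ →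
              (v ∈ Λ δ ↔ m δ ≤ v.1 1))) ∧
        (∀ K : Set ℂ, IsCompact K → K ⊆ D.carrier →
            ∀ᶠ δ : ℝ in 𝓝[>] 0, ∀ v : HexVertex, (δ : ℂ) * hexCenter v ∈ K → v ∈ Λ δ) ∧
        Tendsto (fun δ : ℝ => (δ : ℂ) * hexMidpoint (b δ)) (𝓝[>] 0) (𝓝 (D.pt 1))) →
    ∀ (a : ℝ → Sym2 HexVertex) (r₀ : ℝ) (m₀ : ℝ → ℤ),
      (0 < r₀ ∧
        D.carrier ∩ Metric.ball (D.pt 0) r₀ = {z : ℂ | (D.pt 0).im < z.im} ∩ Metric.ball (D.pt 0) r₀ ∧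
        (∀ᶠ δ : ℝ in 𝓝[>] 0, a δ ∈ hexDomainBoundary (Λ δ) ∧
            Nonempty (HexMidEdgeSAW (Λ δ) (a δ) (b δ)) ∧
            (∀ v : HexVertex, (δ : ℂ) * hexCenter v ∈ Metric.ball (D.pt 0) r₀ →
              (v ∈ Λ δ ↔ m₀ δ ≤ v.1 1))) ∧
        Tendsto (fun δ : ℝ => (δ : ℂ) * hexMidpoint (a δ)) (𝓝[>] 0) (𝓝 (D.pt 0))) →
    ∀ K : Set ℂ, IsCompact K → K ⊆ D.carrier → ∃ C : ℝ, ∀ᶠ δ : ℝ in 𝓝[>] 0,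
      δ ^ 2 * (∑ᶠ z ∈ {z : Sym2 HexVertex | z ∈ hexDomainMidEdges (Λ δ) ∧ (δ : ℂ) * hexMidpoint z ∈ K},
          ‖hexParafermionicObservable (Λ δ) (a δ) hexCriticalFugacity (5 / 8) z‖) ≤
        C * ‖hexParafermionicObservable (Λ δ) (a δ) hexCriticalFugacity (5 / 8) (b δ)‖) ∧
    (∃ c : ℂ, c ≠ 0 ∧
    ∀ (D : DobrushinDomain) (ρ : ℝ) (Λ : ℝ → Finset HexVertex) (m : ℝ → ℤ) (b : ℝ → Sym2 HexVertex),
      (0 < ρ ∧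
        D.carrier ∩ Metric.ball (D.pt 1) ρ = {z : ℂ | (D.pt 1).im < z.im} ∩ Metric.ball (D.pt 1) ρ ∧
        (∀ᶠ δ : ℝ in 𝓝[>] 0, hexDomainSimplyConnected (Λ δ) ∧ b δ ∈ hexDomainBoundary (Λ δ) ∧
            (hexGraph.induce ((Λ δ : Finset HexVertex) : Set HexVertex)).Preconnected ∧
            (∀ v ∈ Λ δ, (δ : ℂ) * hexCenter v ∈ D.carrier) ∧
            (∀ v : HexVertex, (δ : ℂ) * hexCenter v ∈ Metric.ball (D.pt 1) ρ →
              (v ∈ Λ δ ↔ m δ ≤ v.1 1))) ∧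
        (∀ K : Set ℂ, IsCompact K → K ⊆ D.carrier →
            ∀ᶠ δ : ℝ in 𝓝[>] 0, ∀ v : HexVertex, (δ : ℂ) * hexCenter v ∈ K → v ∈ Λ δ) ∧
        Tendsto (fun δ : ℝ => (δ : ℂ) * hexMidpoint (b δ)) (𝓝[>] 0) (𝓝 (D.pt 1))) →
    ∀ (a : ℝ → Sym2 HexVertex) (r₀ : ℝ) (m₀ : ℝ → ℤ),
      (0 < r₀ ∧
        D.carrier ∩ Metric.ball (D.pt 0) r₀ = {z : ℂ | (D.pt 0).im < z.im} ∩ Metric.ball (D.pt 0) r₀ ∧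
        (∀ᶠ δ : ℝ in 𝓝[>] 0, a δ ∈ hexDomainBoundary (Λ δ) ∧
            Nonempty (HexMidEdgeSAW (Λ δ) (a δ) (b δ)) ∧
            (∀ v : HexVertex, (δ : ℂ) * hexCenter v ∈ Metric.ball (D.pt 0) r₀ →
              (v ∈ Λ δ ↔ m₀ δ ≤ v.1 1))) ∧
        Tendsto (fun δ : ℝ => (δ : ℂ) * hexMidpoint (a δ)) (𝓝[>] 0) (𝓝 (D.pt 0))) →
    ∀ (Φ : ConformalEquiv D.carrier UpperHalfPlane.upperHalfPlaneSet) (L : ℂ → ℂ) (Lb : ℂ),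
      Tendsto (fun z => ‖Φ z‖) (𝓝[D.carrier] (D.pt 0)) atTop → Φ.HasBoundaryValue (D.pt 1) 0 →
      ContinuousOn L D.carrier → (∀ z ∈ D.carrier, Complex.exp (L z) = deriv Φ z) →
      Tendsto L (𝓝[D.carrier] (D.pt 1)) (𝓝 Lb) →
    ∀ ns : ℕ → ℝ, Tendsto ns atTop (𝓝[>] 0) →
    ∀ g : ℂ → ℂ, DifferentiableOn ℂ g D.carrier →
      (∀ ψ : ℂ → ℂ, (Continuous ψ ∧ HasCompactSupport ψ ∧ tsupport ψ ⊆ D.carrier) →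
        Tendsto (fun n => ((ns n : ℝ) : ℂ) ^ 2 * (∑ᶠ z ∈ hexDomainMidEdges (Λ (ns n)),
            ψ (((ns n : ℝ) : ℂ) * hexMidpoint z) *
              hexParafermionicObservable (Λ (ns n)) (a (ns n)) hexCriticalFugacity (5 / 8) z) /
          hexParafermionicObservable (Λ (ns n)) (a (ns n)) hexCriticalFugacity (5 / 8) (b (ns n)))
          atTop (𝓝 (∫ z, ψ z * g z))) →
      ∀ y : ℂ, y.im = (D.pt 1).im → y ∈ Metric.ball (D.pt 1) ρ →
        Tendsto (fun z => g z * Complex.exp (-((5 / 8 : ℂ) * (L z - Lb)))) (𝓝[D.carrier] y) (𝓝 c)) :=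
  ⟨Summit.CriticalPhenomena.SAWScalingLimit.Theorems.PickHalfPlane.LocalL1.localL1Root_of_target
      Summit.CriticalPhenomena.SAWScalingLimit.Theorems.PickHalfPlane.Identification.frameDatum_exists hX,
    Summit.CriticalPhenomena.SAWScalingLimit.Theorems.PickHalfPlane.Identification.gateTraceH_of_target hX⟩

/-- **EQUIVALENCE modulo the exponent cruxes** (registered sub-goal `target_iff_inputs` of crux
stmt-CriticalPhenomena-14004, r15): given `DefectDecoherence` and `MassRatio`, the target
`HexObservableLimitR` holds iff the local `L¹` law at the root AND the gate trace of holomorphic weak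
limits hold. -/
theorem target_iff_inputs :
DefectDecoherence → MassRatio →
 (HexObservableLimitR ↔
 ((∀ (D : DobrushinDomain) (ρ : ℝ) (Λ : ℝ → Finset HexVertex) (m : ℝ → ℤ) (b : ℝ → Sym2 HexVertex),
  (0 < ρ ∧
   D.carrier ∩ Metric.ball (D.pt 1) ρ = {z : ℂ | (D.pt 1).im < z.im} ∩ Metric.ball (D.pt 1) ρ ∧
   (∀ᶠ δ : ℝ in 𝓝[>] 0, hexDomainSimplyConnected (Λ δ) ∧ b δ ∈ hexDomainBoundary (Λ δ) ∧
    (hexGraph.induce ((Λ δ : Finset HexVertex) : Set HexVertex)).Preconnected ∧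
    (∀ v ∈ Λ δ, (δ : ℂ) * hexCenter v ∈ D.carrier) ∧
    (∀ v : HexVertex, (δ : ℂ) * hexCenter v ∈ Metric.ball (D.pt 1) ρ → (v ∈ Λ δ ↔ m δ ≤ v.1 1))) ∧
   (∀ K : Set ℂ, IsCompact K → K ⊆ D.carrier →
    ∀ᶠ δ : ℝ in 𝓝[>] 0, ∀ v : HexVertex, (δ : ℂ) * hexCenter v ∈ K → v ∈ Λ δ) ∧
   Tendsto (fun δ : ℝ => (δ : ℂ) * hexMidpoint (b δ)) (𝓝[>] 0) (𝓝 (D.pt 1))) →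
 ∀ (a : ℝ → Sym2 HexVertex) (r₀ : ℝ) (m₀ : ℝ → ℤ),
  (0 < r₀ ∧
   D.carrier ∩ Metric.ball (D.pt 0) r₀ = {z : ℂ | (D.pt 0).im < z.im} ∩ Metric.ball (D.pt 0) r₀ ∧
   (∀ᶠ δ : ℝ in 𝓝[>] 0, a δ ∈ hexDomainBoundary (Λ δ) ∧ Nonempty (HexMidEdgeSAW (Λ δ) (a δ) (b δ)) ∧
    (∀ v : HexVertex, (δ : ℂ) * hexCenter v ∈ Metric.ball (D.pt 0) r₀ → (v ∈ Λ δ ↔ m₀ δ ≤ v.1 1))) ∧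
   Tendsto (fun δ : ℝ => (δ : ℂ) * hexMidpoint (a δ)) (𝓝[>] 0) (𝓝 (D.pt 0))) →
 ∀ K : Set ℂ, IsCompact K → K ⊆ D.carrier → ∃ C : ℝ, ∀ᶠ δ : ℝ in 𝓝[>] 0,
  δ ^ 2 * (∑ᶠ z ∈ {z : Sym2 HexVertex | z ∈ hexDomainMidEdges (Λ δ) ∧ (δ : ℂ) * hexMidpoint z ∈ K},
   ‖hexParafermionicObservable (Λ δ) (a δ) hexCriticalFugacity (5 / 8) z‖) ≤
  C * ‖hexParafermionicObservable (Λ δ) (a δ) hexCriticalFugacity (5 / 8) (b δ)‖) ∧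
 (∃ c : ℂ, c ≠ 0 ∧
 ∀ (D : DobrushinDomain) (ρ : ℝ) (Λ : ℝ → Finset HexVertex) (m : ℝ → ℤ) (b : ℝ → Sym2 HexVertex),
  (0 < ρ ∧
   D.carrier ∩ Metric.ball (D.pt 1) ρ = {z : ℂ | (D.pt 1).im < z.im} ∩ Metric.ball (D.pt 1) ρ ∧
   (∀ᶠ δ : ℝ in 𝓝[>] 0, hexDomainSimplyConnected (Λ δ) ∧ b δ ∈ hexDomainBoundary (Λ δ) ∧
    (hexGraph.induce ((Λ δ : Finset HexVertex) : Set HexVertex)).Preconnected ∧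
    (∀ v ∈ Λ δ, (δ : ℂ) * hexCenter v ∈ D.carrier) ∧
    (∀ v : HexVertex, (δ : ℂ) * hexCenter v ∈ Metric.ball (D.pt 1) ρ → (v ∈ Λ δ ↔ m δ ≤ v.1 1))) ∧
   (∀ K : Set ℂ, IsCompact K → K ⊆ D.carrier →
    ∀ᶠ δ : ℝ in 𝓝[>] 0, ∀ v : HexVertex, (δ : ℂ) * hexCenter v ∈ K → v ∈ Λ δ) ∧
   Tendsto (fun δ : ℝ => (δ : ℂ) * hexMidpoint (b δ)) (𝓝[>] 0) (𝓝 (D.pt 1))) →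
 ∀ (a : ℝ → Sym2 HexVertex) (r₀ : ℝ) (m₀ : ℝ → ℤ),
  (0 < r₀ ∧
   D.carrier ∩ Metric.ball (D.pt 0) r₀ = {z : ℂ | (D.pt 0).im < z.im} ∩ Metric.ball (D.pt 0) r₀ ∧
   (∀ᶠ δ : ℝ in 𝓝[>] 0, a δ ∈ hexDomainBoundary (Λ δ) ∧ Nonempty (HexMidEdgeSAW (Λ δ) (a δ) (b δ)) ∧
    (∀ v : HexVertex, (δ : ℂ) * hexCenter v ∈ Metric.ball (D.pt 0) r₀ → (v ∈ Λ δ ↔ m₀ δ ≤ v.1 1))) ∧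
   Tendsto (fun δ : ℝ => (δ : ℂ) * hexMidpoint (a δ)) (𝓝[>] 0) (𝓝 (D.pt 0))) →
 ∀ (Φ : ConformalEquiv D.carrier UpperHalfPlane.upperHalfPlaneSet) (L : ℂ → ℂ) (Lb : ℂ),
  Tendsto (fun z => ‖Φ z‖) (𝓝[D.carrier] (D.pt 0)) atTop → Φ.HasBoundaryValue (D.pt 1) 0 →
  ContinuousOn L D.carrier → (∀ z ∈ D.carrier, Complex.exp (L z) = deriv Φ z) →
  Tendsto L (𝓝[D.carrier] (D.pt 1)) (𝓝 Lb) →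
 ∀ ns : ℕ → ℝ, Tendsto ns atTop (𝓝[>] 0) → ∀ g : ℂ → ℂ, DifferentiableOn ℂ g D.carrier →
 (∀ ψ : ℂ → ℂ, (Continuous ψ ∧ HasCompactSupport ψ ∧ tsupport ψ ⊆ D.carrier) →
  Tendsto (fun n => ((ns n : ℝ) : ℂ) ^ 2 * (∑ᶠ z ∈ hexDomainMidEdges (Λ (ns n)),
   ψ (((ns n : ℝ) : ℂ) * hexMidpoint z) * hexParafermionicObservable (Λ (ns n)) (a (ns n)) hexCriticalFugacity (5 / 8) z) /
   hexParafermionicObservable (Λ (ns n)) (a (ns n)) hexCriticalFugacity (5 / 8) (b (ns n))) atTop (𝓝 (∫ z, ψ z * g z))) →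
 ∀ y : ℂ, y.im = (D.pt 1).im → y ∈ Metric.ball (D.pt 1) ρ →
  Tendsto (fun z => g z * Complex.exp (-((5 / 8 : ℂ) * (L z - Lb)))) (𝓝[D.carrier] y) (𝓝 c)))) :=
  fun hDD hMR => ⟨inputs_of_target, fun h => target_of_inputs hDD hMR h.1 h.2⟩

/-- **The crux read as its two inputs**: `BoundaryClosureR ↔ (DefectDecoherence → MassRatio →
L¹-law ∧ gate-trace)`. -/
theorem boundaryClosureR_iff_inputs :
    BoundaryClosureR ↔
    (DefectDecoherence → MassRatio →
    ((∀ (D : DobrushinDomain) (ρ : ℝ) (Λ : ℝ → Finset HexVertex) (m : ℝ → ℤ) (b : ℝ → Sym2 HexVertex),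
      (0 < ρ ∧
        D.carrier ∩ Metric.ball (D.pt 1) ρ = {z : ℂ | (D.pt 1).im < z.im} ∩ Metric.ball (D.pt 1) ρ ∧
        (∀ᶠ δ : ℝ in 𝓝[>] 0, hexDomainSimplyConnected (Λ δ) ∧ b δ ∈ hexDomainBoundary (Λ δ) ∧
            (hexGraph.induce ((Λ δ : Finset HexVertex) : Set HexVertex)).Preconnected ∧
            (∀ v ∈ Λ δ, (δ : ℂ) * hexCenter v ∈ D.carrier) ∧
            (∀ v : HexVertex, (δ : ℂ) * hexCenter v ∈ Metric.ball (D.pt 1) ρ →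
              (v ∈ Λ δ ↔ m δ ≤ v.1 1))) ∧
        (∀ K : Set ℂ, IsCompact K → K ⊆ D.carrier →
            ∀ᶠ δ : ℝ in 𝓝[>] 0, ∀ v : HexVertex, (δ : ℂ) * hexCenter v ∈ K → v ∈ Λ δ) ∧
        Tendsto (fun δ : ℝ => (δ : ℂ) * hexMidpoint (b δ)) (𝓝[>] 0) (𝓝 (D.pt 1))) →
    ∀ (a : ℝ → Sym2 HexVertex) (r₀ : ℝ) (m₀ : ℝ → ℤ),
      (0 < r₀ ∧
        D.carrier ∩ Metric.ball (D.pt 0) r₀ = {z : ℂ | (D.pt 0).im < z.im} ∩ Metric.ball (D.pt 0) r₀ ∧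
        (∀ᶠ δ : ℝ in 𝓝[>] 0, a δ ∈ hexDomainBoundary (Λ δ) ∧
            Nonempty (HexMidEdgeSAW (Λ δ) (a δ) (b δ)) ∧
            (∀ v : HexVertex, (δ : ℂ) * hexCenter v ∈ Metric.ball (D.pt 0) r₀ →
              (v ∈ Λ δ ↔ m₀ δ ≤ v.1 1))) ∧
        Tendsto (fun δ : ℝ => (δ : ℂ) * hexMidpoint (a δ)) (𝓝[>] 0) (𝓝 (D.pt 0))) →
    ∀ K : Set ℂ, IsCompact K → K ⊆ D.carrier → ∃ C : ℝ, ∀ᶠ δ : ℝ in 𝓝[>] 0,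
      δ ^ 2 * (∑ᶠ z ∈ {z : Sym2 HexVertex | z ∈ hexDomainMidEdges (Λ δ) ∧ (δ : ℂ) * hexMidpoint z ∈ K},
          ‖hexParafermionicObservable (Λ δ) (a δ) hexCriticalFugacity (5 / 8) z‖) ≤
        C * ‖hexParafermionicObservable (Λ δ) (a δ) hexCriticalFugacity (5 / 8) (b δ)‖) ∧
    (∃ c : ℂ, c ≠ 0 ∧
    ∀ (D : DobrushinDomain) (ρ : ℝ) (Λ : ℝ → Finset HexVertex) (m : ℝ → ℤ) (b : ℝ → Sym2 HexVertex),
      (0 < ρ ∧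
        D.carrier ∩ Metric.ball (D.pt 1) ρ = {z : ℂ | (D.pt 1).im < z.im} ∩ Metric.ball (D.pt 1) ρ ∧
        (∀ᶠ δ : ℝ in 𝓝[>] 0, hexDomainSimplyConnected (Λ δ) ∧ b δ ∈ hexDomainBoundary (Λ δ) ∧
            (hexGraph.induce ((Λ δ : Finset HexVertex) : Set HexVertex)).Preconnected ∧
            (∀ v ∈ Λ δ, (δ : ℂ) * hexCenter v ∈ D.carrier) ∧
            (∀ v : HexVertex, (δ : ℂ) * hexCenter v ∈ Metric.ball (D.pt 1) ρ →
              (v ∈ Λ δ ↔ m δ ≤ v.1 1))) ∧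
        (∀ K : Set ℂ, IsCompact K → K ⊆ D.carrier →
            ∀ᶠ δ : ℝ in 𝓝[>] 0, ∀ v : HexVertex, (δ : ℂ) * hexCenter v ∈ K → v ∈ Λ δ) ∧
        Tendsto (fun δ : ℝ => (δ : ℂ) * hexMidpoint (b δ)) (𝓝[>] 0) (𝓝 (D.pt 1))) →
    ∀ (a : ℝ → Sym2 HexVertex) (r₀ : ℝ) (m₀ : ℝ → ℤ),
      (0 < r₀ ∧
        D.carrier ∩ Metric.ball (D.pt 0) r₀ = {z : ℂ | (D.pt 0).im < z.im} ∩ Metric.ball (D.pt 0) r₀ ∧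
        (∀ᶠ δ : ℝ in 𝓝[>] 0, a δ ∈ hexDomainBoundary (Λ δ) ∧
            Nonempty (HexMidEdgeSAW (Λ δ) (a δ) (b δ)) ∧
            (∀ v : HexVertex, (δ : ℂ) * hexCenter v ∈ Metric.ball (D.pt 0) r₀ →
              (v ∈ Λ δ ↔ m₀ δ ≤ v.1 1))) ∧
        Tendsto (fun δ : ℝ => (δ : ℂ) * hexMidpoint (a δ)) (𝓝[>] 0) (𝓝 (D.pt 0))) →
    ∀ (Φ : ConformalEquiv D.carrier UpperHalfPlane.upperHalfPlaneSet) (L : ℂ → ℂ) (Lb : ℂ),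
      Tendsto (fun z => ‖Φ z‖) (𝓝[D.carrier] (D.pt 0)) atTop → Φ.HasBoundaryValue (D.pt 1) 0 →
      ContinuousOn L D.carrier → (∀ z ∈ D.carrier, Complex.exp (L z) = deriv Φ z) →
      Tendsto L (𝓝[D.carrier] (D.pt 1)) (𝓝 Lb) →
    ∀ ns : ℕ → ℝ, Tendsto ns atTop (𝓝[>] 0) →
    ∀ g : ℂ → ℂ, DifferentiableOn ℂ g D.carrier →
      (∀ ψ : ℂ → ℂ, (Continuous ψ ∧ HasCompactSupport ψ ∧ tsupport ψ ⊆ D.carrier) →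
        Tendsto (fun n => ((ns n : ℝ) : ℂ) ^ 2 * (∑ᶠ z ∈ hexDomainMidEdges (Λ (ns n)),
            ψ (((ns n : ℝ) : ℂ) * hexMidpoint z) *
              hexParafermionicObservable (Λ (ns n)) (a (ns n)) hexCriticalFugacity (5 / 8) z) /
          hexParafermionicObservable (Λ (ns n)) (a (ns n)) hexCriticalFugacity (5 / 8) (b (ns n)))
          atTop (𝓝 (∫ z, ψ z * g z))) →
      ∀ y : ℂ, y.im = (D.pt 1).im → y ∈ Metric.ball (D.pt 1) ρ →
        Tendsto (fun z => g z * Complex.exp (-((5 / 8 : ℂ) * (L z - Lb)))) (𝓝[D.carrier] y) (𝓝 c)))) :=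
  ⟨fun hBC hDD hMR => inputs_of_target (hBC hDD hMR),
    fun h hDD hMR => (target_iff_inputs hDD hMR).2 (h hDD hMR)⟩

end Summit.CriticalPhenomena.SAWScalingLimit.Theorems.PickHalfPlane.Equivalence

end
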